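import Literature.AlgebraicGeometry.Resolution.EtaleChartInField
import Mathlib.RingTheory.Valuation.LocalSubring
import Mathlib.Algebra.Field.Equiv
import HarnessLib

/-!
# Étale algebras over a normal domain are normal; membership through valuation rings

Topic: `Literature/AlgebraicGeometry/Resolution` (valued function fields; étale charts of models).
Continuation of `EtaleChartInField.lean`, groundwork for the algebraization step of M. Temkin,
*Inseparable local uniformization*, J. Algebra 373 (2013) = arXiv:0804.1554v3, Thm. 3.3.1: the
two explicit étale charts of the common smooth roof are realized as subrings of the henselized
function field, and most of the identifications between them ("`x′ ∈ T_D`", "`η ∈ T_D`",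
"`N″ ⊆ T_E`") are instances of ONE principle — a domain `T` étale over an integrally closed
domain `R` is integrally closed (The Stacks Project, Tag 025P/033C: étale over normal is normal),
so an element of its fraction field lies in `T` as soon as it lies in every valuation ring
containing `T` (Zariski–Samuel; Mathlib's `iInf_valuationSubring_superset`).

* `exists_mul_eq_algebraMap_of_etale` — every non-zero `t ∈ T` divides a non-zero constant:
  `t t′ = c ∈ R ∖ 0` (`Frac(R) ⊗_R T` is étale over the field `Frac R`, finite
  (`Algebra.FormallyUnramified.finite_of_free`) and a domain, hence a field) — PROVED;
* `isIntegrallyClosed_of_etale` — `T` is integrally closed — PROVED (from the relative statement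
  `mem_range_of_isIntegral_of_etale` of `EtaleChartInField.lean`);
* `mem_range_of_isIntegral_of_mul_eq` — for `T ↪ L` a field: `z ∈ L` integral over `T` with
  `u z = t` (`u, t ∈ T`, `u ≠ 0`) lies in `T` — PROVED;
* `isIntegral_of_forall_valuationSubring`, `mem_range_of_forall_valuationSubring` — the valuative
  form: `z` lies in every valuation subring of `L` containing `T` (and `u z = t`) ⇒ `z ∈ T` —
  PROVED.

All statements are [folklore]; no definitions, no named facts.

## Sources

* The Stacks Project, Tag 033C (normality is étale-local: `R → T` étale, `R` normal ⇒ `T`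
  normal) and Tag 00U3 (étale algebras over a field), through Mathlib.
* O. Zariski, P. Samuel, *Commutative Algebra* II, Ch. VI §4, Thm. 6 (the integral closure is the
  intersection of the valuation rings), through Mathlib.
* M. Temkin, arXiv:0804.1554v3, proof of Thm. 3.3.1, Step 3 and Thm. 2.4.3 (the uses).
-/

noncomputable section

open TensorProduct

namespace Literature.AlgebraicGeometry.Resolution

universe u

section Domain

variable {R T : Type u} [CommRing R] [IsDomain R] [IsIntegrallyClosed R] [CommRing T] [IsDomain T]
  [Algebra R T] [Algebra.Etale R T]

omit [IsIntegrallyClosed R] in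
/-- **`Frac(R) ⊗_R T` is a field** for a domain `T` étale over a domain `R` with `R → T`
injective: it is the localization of `T` at `R ∖ 0`, a domain, and finite étale over the field
`Frac R`. [folklore] -/
theorem isField_fractionRing_tensor_of_etale (hRT : Function.Injective (algebraMap R T)) :
    IsField (FractionRing R ⊗[R] T) := by
  let F := FractionRing R
  let A := F ⊗[R] T
  haveI : Algebra.Etale F A := inferInstance
  haveI : Module.Finite F A := Algebra.FormallyUnramified.finite_of_free F A
  haveI : Algebra.IsIntegral F A := inferInstance
  -- `A ≅ T ⊗ F`, the localization of `T` at the non-zero constants, is a domain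
  let TF := T ⊗[R] F
  haveI : IsLocalization (Algebra.algebraMapSubmonoid T (nonZeroDivisors R)) TF :=
    IsLocalization.tensor F (nonZeroDivisors R)
  have hM : Algebra.algebraMapSubmonoid T (nonZeroDivisors R) ≤ nonZeroDivisors T := by
    rintro _ ⟨c, hc, rfl⟩
    exact mem_nonZeroDivisors_of_ne_zero
      ((map_ne_zero_iff _ hRT).mpr (nonZeroDivisors.ne_zero hc))
  haveI : IsDomain TF := IsLocalization.isDomain_of_le_nonZeroDivisors TF hM
  let c : A ≃ₐ[R] TF := Algebra.TensorProduct.comm R F T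
  haveI : IsDomain A := Function.Injective.isDomain (c : A →+* TF) c.injective
  exact isField_of_isIntegral_of_isField' (R := F) (S := A) (Field.toIsField F)

omit [IsIntegrallyClosed R] in
/-- **A non-zero element of a domain étale over a domain divides a non-zero constant**:
`t t′ = c` with `c ∈ R ∖ 0`. [folklore] -/
theorem exists_mul_eq_algebraMap_of_etale (hRT : Function.Injective (algebraMap R T)) {t : T}
    (ht : t ≠ 0) : ∃ (t' : T) (c : R), c ≠ 0 ∧ t * t' = algebraMap R T c := by
  let F := FractionRing R
  let TF := T ⊗[R] F
  haveI : IsLocalization (Algebra.algebraMapSubmonoid T (nonZeroDivisors R)) TF :=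
    IsLocalization.tensor F (nonZeroDivisors R)
  have hM : Algebra.algebraMapSubmonoid T (nonZeroDivisors R) ≤ nonZeroDivisors T := by
    rintro _ ⟨c, hc, rfl⟩
    exact mem_nonZeroDivisors_of_ne_zero
      ((map_ne_zero_iff _ hRT).mpr (nonZeroDivisors.ne_zero hc))
  have hinj : Function.Injective (algebraMap T TF) := IsLocalization.injective TF hM
  -- `TF` is a field
  have hTF : IsField TF :=
    MulEquiv.isField (isField_fractionRing_tensor_of_etale hRT)
      ((Algebra.TensorProduct.comm R F T).symm : TF ≃ₐ[R] F ⊗[R] T).toMulEquiv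
  -- invert `t` in `TF` and write the inverse as `t′ / c`
  have ht' : algebraMap T TF t ≠ 0 := (map_ne_zero_iff _ hinj).mpr ht
  obtain ⟨w, hw⟩ := hTF.mul_inv_cancel ht'
  obtain ⟨⟨t', y⟩, rfl⟩ :=
    IsLocalization.mk'_surjective (Algebra.algebraMapSubmonoid T (nonZeroDivisors R)) w
  obtain ⟨c, hc, hcy⟩ := Submonoid.mem_map.mp y.2
  refine ⟨t', c, nonZeroDivisors.ne_zero hc, hinj ?_⟩
  have h1 : algebraMap T TF t * IsLocalization.mk' TF t' y * algebraMap T TF (y : T) =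
      algebraMap T TF (y : T) := by
    have hw' : algebraMap T TF t * IsLocalization.mk' TF t' y = 1 := hw
    rw [hw', one_mul]
  rw [mul_assoc, IsLocalization.mk'_spec TF t' y, ← map_mul] at h1
  rw [h1, hcy]

/-- **Étale over normal is normal**: a domain étale over an integrally closed domain (with
injective structure map) is integrally closed. [folklore] -/
theorem isIntegrallyClosed_of_etale (hRT : Function.Injective (algebraMap R T)) :
    IsIntegrallyClosed T := by
  let L := FractionRing T
  have hT : Function.Injective (algebraMap T L) := IsFractionRing.injective T L
  have hR : Function.Injective (algebraMap R L) := by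
    rw [IsScalarTower.algebraMap_eq R T L]
    exact hT.comp hRT
  refine (isIntegrallyClosed_iff L).mpr fun {z} hz => ?_
  obtain ⟨a, b, hb, rfl⟩ := IsFractionRing.div_surjective (A := T) z
  have hb0 : b ≠ 0 := nonZeroDivisors.ne_zero hb
  obtain ⟨t', c, hc, hbt⟩ := exists_mul_eq_algebraMap_of_etale hRT hb0
  have hb' : algebraMap T L b ≠ 0 := (map_ne_zero_iff _ hT).mpr hb0
  have hzt : algebraMap R L c * (algebraMap T L a / algebraMap T L b) =
      algebraMap T L (a * t') := by
    rw [IsScalarTower.algebraMap_apply R T L, ← hbt, map_mul, map_mul, div_eq_mul_inv]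
    have hb1 : algebraMap T L b * (algebraMap T L b)⁻¹ = 1 := mul_inv_cancel₀ hb'
    linear_combination (algebraMap T L t' * algebraMap T L a) * hb1
  obtain ⟨y, hy⟩ := mem_range_of_isIntegral_of_etale hR hT hz hc hzt
  exact ⟨y, hy⟩

end Domain

/-! ### Inside a field: membership through integrality and through valuation rings -/

section InField

variable {R T L : Type u} [CommRing R] [IsDomain R] [IsIntegrallyClosed R] [CommRing T] [Algebra R T]
  [Algebra.Etale R T] [Field L] [Algebra R L] [Algebra T L] [IsScalarTower R T L]

/-- **Membership from integrality and a fraction form**: for `T` étale over an integrally closed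
domain `R`, realized in a field `L` (`R → L`, `T → L` injective), an element `z ∈ L` which is
integral over `T` and satisfies `u z = t` with `u, t ∈ T`, `u ≠ 0`, lies in `T`. [folklore] -/
theorem mem_range_of_isIntegral_of_mul_eq (hR : Function.Injective (algebraMap R L))
    (hT : Function.Injective (algebraMap T L)) {z : L} (hz : IsIntegral T z)
    {u t : T} (hu : u ≠ 0) (hzu : algebraMap T L u * z = algebraMap T L t) :
    z ∈ (algebraMap T L).range := by
  haveI : IsDomain T := Function.Injective.isDomain (algebraMap T L) hT
  have hRT : Function.Injective (algebraMap R T) := by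
    intro a b h
    apply hR
    rw [IsScalarTower.algebraMap_apply R T L a, h, ← IsScalarTower.algebraMap_apply]
  obtain ⟨u', c, hc, huc⟩ := exists_mul_eq_algebraMap_of_etale hRT hu
  have hzt : algebraMap R L c * z = algebraMap T L (u' * t) := by
    rw [IsScalarTower.algebraMap_apply R T L, ← huc, map_mul, map_mul, mul_comm (algebraMap T L u),
      mul_assoc, hzu]
  exact mem_range_of_isIntegral_of_etale hR hT hz hc hzt

omit [IsDomain R] [IsIntegrallyClosed R] [Algebra.Etale R T] in
/-- An element lying in every valuation subring of `L` containing the image of `T` is integral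
over `T`. [folklore] -/
theorem isIntegral_of_forall_valuationSubring {z : L}
    (hval : ∀ W : ValuationSubring L, (∀ x : T, algebraMap T L x ∈ W) → z ∈ W) :
    IsIntegral T z := by
  set s : Set L := Set.range (algebraMap T L) with hs
  have hmem : z ∈ (⨅ W : {W : ValuationSubring L // s ⊆ W.toSubring}, W.1.toSubring) :=
    Subring.mem_iInf.mpr fun W => hval W.1 fun x => W.2 ⟨x, rfl⟩
  rw [iInf_valuationSubring_superset] at hmem
  have h1 : IsIntegral (Subring.closure s) z := hmem
  have hcl : Subring.closure s = (algebraMap T L).range := by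
    rw [hs, ← RingHom.coe_range, Subring.closure_eq]
  obtain ⟨p, hpm, hp⟩ := h1
  -- lift the monic polynomial over the image subring to `T`
  have hlifts : p.map (Subring.closure s).subtype ∈ Polynomial.lifts (algebraMap T L) := by
    refine (Polynomial.lifts_iff_coeff_lifts _).mpr fun n => ?_
    rw [Polynomial.coeff_map]
    have h2 : ((p.coeff n : Subring.closure s) : L) ∈ (algebraMap T L).range := by
      rw [← hcl]
      exact (p.coeff n).2
    exact h2
  haveI : Nontrivial L := inferInstance
  obtain ⟨q, hq, -, hqm⟩ := Polynomial.lifts_and_degree_eq_and_monic hlifts (hpm.map _)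
  refine ⟨q, hqm, ?_⟩
  have h3 : Polynomial.eval₂ (algebraMap T L) z q = (q.map (algebraMap T L)).eval z := by
    rw [Polynomial.eval_map]
  rw [h3, hq, Polynomial.eval_map]
  exact hp

/-- **Valuative membership**: for `T` étale over an integrally closed domain `R`, realized in a
field `L`, an element `z ∈ L` with `u z = t` (`u, t ∈ T`, `u ≠ 0`) which lies in every
valuation subring of `L` containing `T` lies in `T`. [folklore] -/
theorem mem_range_of_forall_valuationSubring (hR : Function.Injective (algebraMap R L))
    (hT : Function.Injective (algebraMap T L)) {z : L}
    (hval : ∀ W : ValuationSubring L, (∀ x : T, algebraMap T L x ∈ W) → z ∈ W)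
    {u t : T} (hu : u ≠ 0) (hzu : algebraMap T L u * z = algebraMap T L t) :
    z ∈ (algebraMap T L).range :=
  mem_range_of_isIntegral_of_mul_eq hR hT (isIntegral_of_forall_valuationSubring hval) hu hzu

end InField

end Literature.AlgebraicGeometry.Resolution

end
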